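import Summits.AtomisticToContinuum.Crystallization.Theorems.FrustratedLawDichotomyStrainedPatchHomEntryFitHcpCentredRotSound

/-!
# CONTAINMENT of the min-pairs consumer in the centred-rotated consumer: `HT5QDMX ⊆ HT5QDCRX` at the verdict, leaf, union and tree level
# (27623 `(H) HomFloor (1/625)`, hcp half; critic row 1189 «consumer move HT5QDMX → HT5QDCRX only with a containment lemma or both kept»)

decomp-a2c hand-1 g32 (crux `AperiodicFrustratedLawGap`, stmt-AtomisticToContinuum-27623).  The inner verdict of the centred-rotated consumer of hand-1 g31,
`…CentredRotSound.entryLeafOKHQDCR μ q := fitOKHDCR q ∨ fitOKHDM ∨ entryLeafOKHQ μ`, CONTAINS the min-pairs inner verdict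
`…MinPairsLeaf.entryLeafOKHQDM μ := fitOKHDM ∨ entryLeafOKHQ μ` as a disjunct, so every certificate accepted by the min-pairs consumer of record
(`…MinPairsLeaf.entryLeafOKHT5QDMX`, E-consumer of critic rows 1185/1187) is accepted by the centred-rotated consumer `…CentredRotSound.entryLeafOKHT5QDCRX`
with ANY rotation payload `Qf` — the consumer move loses nothing:

* `treeOK_mono` — `treeOK` is monotone in the leaf verdict (induction on the certificate tree);
* `entryLeafOKHQDCR_of_QDM`, `entryLeafOKHT5_mono` (the pruned slab leaf is monotone in its inner verdict), `entryLeafOKHT5QDCR_of_QDM`,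
  `entryLeafOKHT5QDCRX_of_QDMX`, ★ `treeOK_HT5QDCRX_of_HT5QDMX` (whole certificate trees), ★ `exists_treeOK_HT5QDCRX_of_HT5QDMX` (the `hH` hypothesis of
  `…CentredRotSound.homFloor_625_of_entryTrees6RBKP_HT5QDCRX` from that of `…MinPairsLeaf.homFloor_625_of_entryTrees6RBKP_HT5QDMX`).

0 sorry; no definitions; standard axioms.  `--supports stmt-AtomisticToContinuum-27623`.
-/

namespace Summit.AtomisticToContinuum.Crystallization.Theorems.FrustratedLawDichotomyStrainedPatchHomEntryLeafHT

open Literature.Analysis.ValidatedNumerics.Numerics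
open Summit.AtomisticToContinuum.Crystallization.Theorems.FrustratedLawDichotomyStrainedPatchHomCertTree (CertTree treeOK)
open Summit.AtomisticToContinuum.Crystallization.Theorems.FrustratedLawDichotomyStrainedPatchHomEntryGramHcp (rootCH rootWH)
open Summit.AtomisticToContinuum.Crystallization.Theorems.FrustratedLawDichotomyStrainedPatchHomEntryFitHcpCentred
  (fitOKHDM entryLeafOKHQDM entryLeafOKHQDCR)

/-- `treeOK` is monotone in the leaf verdict. [formal bookkeeping: induction on the tree] -/
theorem treeOK_mono {κ : Type} [DecidableEq κ] {v₁ v₂ : (κ → ℤ) → (κ → ℤ) → Bool} (hv : ∀ c w, v₁ c w = true → v₂ c w = true) :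
    ∀ (t : CertTree κ) (c w : κ → ℤ), treeOK v₁ t c w = true → treeOK v₂ t c w = true
  | .leaf, c, w, h => hv c w h
  | .split k l r, c, w, h => by
    simp only [treeOK, Bool.and_eq_true] at h ⊢
    exact ⟨⟨h.1.1, treeOK_mono hv l _ _ h.1.2⟩, treeOK_mono hv r _ _ h.2⟩

/-- The min-pairs inner verdict implies the centred-rotated inner verdict (any rotation payload). [formal bookkeeping] -/
theorem entryLeafOKHQDCR_of_QDM {μ : ℤ} (q : Fin 4 → ℤ) {c w : (Fin 3 × Fin 3) ⊕ Fin 3 → ℤ} (h : entryLeafOKHQDM μ c w = true) :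
    entryLeafOKHQDCR μ q c w = true := by
  simp only [entryLeafOKHQDM, entryLeafOKHQDCR, Bool.or_eq_true] at h ⊢
  rcases h with h | h
  · exact Or.inl (Or.inr h)
  · exact Or.inr h

/-- The pruned slab leaf `…HomSlabPrune.entryLeafOKHT5` is monotone in its inner verdict. [formal bookkeeping] -/
theorem entryLeafOKHT5_mono {inner₁ inner₂ : ((Fin 3 × Fin 3) ⊕ Fin 3 → ℤ) → ((Fin 3 × Fin 3) ⊕ Fin 3 → ℤ) → Bool}
    (hv : ∀ c w, inner₁ c w = true → inner₂ c w = true) {p : HTCert} {t : CertTree ((Fin 3 × Fin 3) ⊕ Fin 3)} {c w : (Fin 3 × Fin 3) ⊕ Fin 3 → ℤ}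
    (h : entryLeafOKHT5 inner₁ p t c w = true) : entryLeafOKHT5 inner₂ p t c w = true := by
  simp only [entryLeafOKHT5, Bool.and_eq_true] at h ⊢
  refine ⟨h.1, treeOK_mono (fun c' w' hv' => ?_) t c _ h.2⟩
  simp only [Bool.or_eq_true] at hv' ⊢
  rcases hv' with hv' | hv'
  · exact Or.inl hv'
  · exact Or.inr (hv c' w' hv')

/-- ★ Leaf level: `entryLeafOKHT5QDM ⟹ entryLeafOKHT5QDCR` (same certificate and sub-tree, any rotation payload). [formal bookkeeping] -/
theorem entryLeafOKHT5QDCR_of_QDM {μ : ℤ} (q : Fin 4 → ℤ) {p : HTCert} {t : CertTree ((Fin 3 × Fin 3) ⊕ Fin 3)} {c w : (Fin 3 × Fin 3) ⊕ Fin 3 → ℤ}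
    (h : entryLeafOKHT5QDM μ p t c w = true) : entryLeafOKHT5QDCR μ q p t c w = true :=
  entryLeafOKHT5_mono (fun _ _ h' => entryLeafOKHQDCR_of_QDM q h') h

/-- ★ Union level: `entryLeafOKHT5QDMX μ P T ⟹ entryLeafOKHT5QDCRX μ P Qf T` for ANY payload function `Qf`. [formal bookkeeping] -/
theorem entryLeafOKHT5QDCRX_of_QDMX {μ : ℤ} {P : ((Fin 3 × Fin 3) ⊕ Fin 3 → ℤ) → ((Fin 3 × Fin 3) ⊕ Fin 3 → ℤ) → HTCert}
    (Qf : ((Fin 3 × Fin 3) ⊕ Fin 3 → ℤ) → ((Fin 3 × Fin 3) ⊕ Fin 3 → ℤ) → (Fin 4 → ℤ))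
    {T : ((Fin 3 × Fin 3) ⊕ Fin 3 → ℤ) → ((Fin 3 × Fin 3) ⊕ Fin 3 → ℤ) → CertTree ((Fin 3 × Fin 3) ⊕ Fin 3)}
    {c w : (Fin 3 × Fin 3) ⊕ Fin 3 → ℤ} (h : entryLeafOKHT5QDMX μ P T c w = true) : entryLeafOKHT5QDCRX μ P Qf T c w = true := by
  simp only [entryLeafOKHT5QDMX, entryLeafOKHT5QDCRX, Bool.or_eq_true] at h ⊢
  rcases h with h | h
  · exact Or.inl (entryLeafOKHT5QDCR_of_QDM (Qf c w) h)
  · exact Or.inr h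

/-- ★ **TREE LEVEL: every certificate tree accepted by the min-pairs consumer is accepted by the centred-rotated consumer** (any `Qf`). [formal bookkeeping] -/
theorem treeOK_HT5QDCRX_of_HT5QDMX {μ : ℤ} {P : ((Fin 3 × Fin 3) ⊕ Fin 3 → ℤ) → ((Fin 3 × Fin 3) ⊕ Fin 3 → ℤ) → HTCert}
    (Qf : ((Fin 3 × Fin 3) ⊕ Fin 3 → ℤ) → ((Fin 3 × Fin 3) ⊕ Fin 3 → ℤ) → (Fin 4 → ℤ))
    {T : ((Fin 3 × Fin 3) ⊕ Fin 3 → ℤ) → ((Fin 3 × Fin 3) ⊕ Fin 3 → ℤ) → CertTree ((Fin 3 × Fin 3) ⊕ Fin 3)}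
    {t : CertTree ((Fin 3 × Fin 3) ⊕ Fin 3)} {c w : (Fin 3 × Fin 3) ⊕ Fin 3 → ℤ} (h : treeOK (entryLeafOKHT5QDMX μ P T) t c w = true) :
    treeOK (entryLeafOKHT5QDCRX μ P Qf T) t c w = true :=
  treeOK_mono (fun _ _ h' => entryLeafOKHT5QDCRX_of_QDMX Qf h') t c w h

/-- ★ The `hH` hypothesis of `…CentredRotSound.homFloor_625_of_entryTrees6RBKP_HT5QDCRX` from that of `…MinPairsLeaf.homFloor_625_of_entryTrees6RBKP_HT5QDMX`:
the consumer move `HT5QDMX → HT5QDCRX` keeps every certificate. [formal bookkeeping] -/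
theorem exists_treeOK_HT5QDCRX_of_HT5QDMX {μ : ℤ} {P : ((Fin 3 × Fin 3) ⊕ Fin 3 → ℤ) → ((Fin 3 × Fin 3) ⊕ Fin 3 → ℤ) → HTCert}
    (Qf : ((Fin 3 × Fin 3) ⊕ Fin 3 → ℤ) → ((Fin 3 × Fin 3) ⊕ Fin 3 → ℤ) → (Fin 4 → ℤ))
    {T : ((Fin 3 × Fin 3) ⊕ Fin 3 → ℤ) → ((Fin 3 × Fin 3) ⊕ Fin 3 → ℤ) → CertTree ((Fin 3 × Fin 3) ⊕ Fin 3)}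
    (hH : ∃ t : CertTree ((Fin 3 × Fin 3) ⊕ Fin 3), treeOK (entryLeafOKHT5QDMX μ P T) t rootCH rootWH = true) :
    ∃ t : CertTree ((Fin 3 × Fin 3) ⊕ Fin 3), treeOK (entryLeafOKHT5QDCRX μ P Qf T) t rootCH rootWH = true := by
  obtain ⟨t, ht⟩ := hH
  exact ⟨t, treeOK_HT5QDCRX_of_HT5QDMX Qf ht⟩

end Summit.AtomisticToContinuum.Crystallization.Theorems.FrustratedLawDichotomyStrainedPatchHomEntryLeafHT
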